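import Literature.Computability.Complexity.CodeFPArith
import HarnessLib

/-!
# Arithmetic expressions over an environment, evaluated in typed polynomial time

Topic `Computability/Complexity`. A small deep embedding used to discharge, once and for all, the
"routine" polynomial-time bookkeeping of explicit combinatorial constructions (block starts,
offsets, flags of a gadget layout computed from a few size parameters and lookup tables): an
expression `e : AExp` built from literals, scalar variables, table lookups, `+ - * / %`,
comparisons and a conditional is evaluated by `AExp.eval E e` in an environment
`E = (scalars, tables) : AEnv`, and **`CodeFP.codeFP_eval e : CodeFP aenvE natE (· .eval e)`** —
evaluation of a FIXED expression is typed polynomial time in the code of the environment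
(`CodeFP`, `CodeFP.lean`), by structural induction from the closure properties of `CodeFP.lean` /
`CodeFPArith.lean`. Lists of expressions (`codeFP_evalList`), Boolean flags (`AExp.flag`,
`codeFP_flag`) and environments assembled from computed scalars and tables (`codeFP_mkEnv`) are
provided as well.

## References

* S. Arora, B. Barak, *Computational Complexity: A Modern Approach*, CUP 2009, §1.3 (closure of
  polynomial time under composition; arithmetic on binary numerals) [AroraBarak2009].
-/

namespace Literature.Computability.Complexity

namespace CodeFP

/-- **Arithmetic expressions**: literals, scalar variables, table lookups, arithmetic, comparisons
(valued `1`/`0`) and a conditional. [folklore] -/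
inductive AExp : Type
  | lit (n : ℕ)
  | var (j : ℕ)
  | tbl (k : ℕ) (e : AExp)
  | add (e₁ e₂ : AExp)
  | sub (e₁ e₂ : AExp)
  | mul (e₁ e₂ : AExp)
  | div (e₁ e₂ : AExp)
  | emod (e₁ e₂ : AExp)
  | lt (e₁ e₂ : AExp)
  | beq (e₁ e₂ : AExp)
  | cond (c e₁ e₂ : AExp)
  deriving DecidableEq, Repr

/-- **Environments**: a list of scalars and a list of tables of naturals. [folklore] -/
abbrev AEnv : Type := List ℕ × List (List ℕ)

/-- **Evaluation** (missing scalars and table entries read as `0`; `lt`, `beq` are `1`/`0`;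
`cond c e₁ e₂` is `e₁` if `c ≠ 0`, else `e₂`). [folklore] -/
def AExp.eval (E : AEnv) : AExp → ℕ
  | .lit n => n
  | .var j => E.1.getD j 0
  | .tbl k e => (E.2.getD k []).getD (eval E e) 0
  | .add e₁ e₂ => eval E e₁ + eval E e₂
  | .sub e₁ e₂ => eval E e₁ - eval E e₂
  | .mul e₁ e₂ => eval E e₁ * eval E e₂
  | .div e₁ e₂ => eval E e₁ / eval E e₂
  | .emod e₁ e₂ => eval E e₁ % eval E e₂
  | .lt e₁ e₂ => if eval E e₁ < eval E e₂ then 1 else 0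
  | .beq e₁ e₂ => if eval E e₁ = eval E e₂ then 1 else 0
  | .cond c e₁ e₂ => if eval E c = 0 then eval E e₂ else eval E e₁

/-- **The flag of an expression**: its value is nonzero. [folklore] -/
def AExp.flag (E : AEnv) (e : AExp) : Bool := !decide (e.eval E = 0)

/-- The code of an environment: raw list of binary scalars, raw list of raw tables. [folklore] -/
abbrev aenvE : AEnv → List Bool := pairE (rawE natE) (rawE (rawE natE))

/-- Evaluation of `lit`. [folklore] -/
@[simp] theorem AExp.eval_lit (E : AEnv) (n : ℕ) : (AExp.lit n).eval E = n := rfl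
/-- Evaluation of `var`. [folklore] -/
@[simp] theorem AExp.eval_var (E : AEnv) (j : ℕ) : (AExp.var j).eval E = E.1.getD j 0 := rfl
/-- Evaluation of `tbl`. [folklore] -/
@[simp] theorem AExp.eval_tbl (E : AEnv) (k : ℕ) (e : AExp) : (AExp.tbl k e).eval E = (E.2.getD k []).getD (e.eval E) 0 := rfl
/-- Evaluation of `add`. [folklore] -/
@[simp] theorem AExp.eval_add (E : AEnv) (e₁ e₂ : AExp) : (AExp.add e₁ e₂).eval E = e₁.eval E + e₂.eval E := rfl
/-- Evaluation of `sub`. [folklore] -/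
@[simp] theorem AExp.eval_sub (E : AEnv) (e₁ e₂ : AExp) : (AExp.sub e₁ e₂).eval E = e₁.eval E - e₂.eval E := rfl
/-- Evaluation of `mul`. [folklore] -/
@[simp] theorem AExp.eval_mul (E : AEnv) (e₁ e₂ : AExp) : (AExp.mul e₁ e₂).eval E = e₁.eval E * e₂.eval E := rfl
/-- Evaluation of `div`. [folklore] -/
@[simp] theorem AExp.eval_div (E : AEnv) (e₁ e₂ : AExp) : (AExp.div e₁ e₂).eval E = e₁.eval E / e₂.eval E := rfl
/-- Evaluation of `emod`. [folklore] -/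
@[simp] theorem AExp.eval_emod (E : AEnv) (e₁ e₂ : AExp) : (AExp.emod e₁ e₂).eval E = e₁.eval E % e₂.eval E := rfl
/-- Evaluation of `lt`. [folklore] -/
@[simp] theorem AExp.eval_lt (E : AEnv) (e₁ e₂ : AExp) :
    (AExp.lt e₁ e₂).eval E = if e₁.eval E < e₂.eval E then 1 else 0 := rfl
/-- Evaluation of `beq`. [folklore] -/
@[simp] theorem AExp.eval_beq (E : AEnv) (e₁ e₂ : AExp) :
    (AExp.beq e₁ e₂).eval E = if e₁.eval E = e₂.eval E then 1 else 0 := rfl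
/-- Evaluation of `cond`. [folklore] -/
@[simp] theorem AExp.eval_cond (E : AEnv) (c e₁ e₂ : AExp) :
    (AExp.cond c e₁ e₂).eval E = if c.eval E = 0 then e₂.eval E else e₁.eval E := rfl

/-- The flag of a comparison. [folklore] -/
theorem AExp.flag_lt (E : AEnv) (e₁ e₂ : AExp) : (AExp.lt e₁ e₂).flag E = decide (e₁.eval E < e₂.eval E) := by
  unfold AExp.flag; rw [AExp.eval_lt]; split_ifs with h <;> simp [h]

/-- The flag of an equality test. [folklore] -/
theorem AExp.flag_beq (E : AEnv) (e₁ e₂ : AExp) : (AExp.beq e₁ e₂).flag E = decide (e₁.eval E = e₂.eval E) := by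
  unfold AExp.flag; rw [AExp.eval_beq]; split_ifs with h <;> simp [h]

/-! ### Evaluation is typed polynomial time -/

/-- **Evaluation of a fixed expression is typed polynomial time** in the environment. [cite: AroraBarak2009, §1.3] -/
theorem codeFP_eval : ∀ e : AExp, CodeFP aenvE natE (fun E => e.eval E)
  | .lit n => const _ n
  | .var j => ((rawGetD natE (d := 0) rfl).comp ((fst _ _).pair (const _ j))).congr fun _ => rfl
  | .tbl k e => by
    have ht : CodeFP aenvE (rawE natE) (fun E => E.2.getD k []) :=
      ((rawGetD (rawE natE) (d := []) rfl).comp ((snd _ _).pair (const _ k))).congr fun _ => rfl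
    exact ((rawGetD natE (d := 0) rfl).comp (ht.pair (codeFP_eval e))).congr fun _ => rfl
  | .add e₁ e₂ => (natAdd.comp ((codeFP_eval e₁).pair (codeFP_eval e₂))).congr fun _ => rfl
  | .sub e₁ e₂ => (natSub.comp ((codeFP_eval e₁).pair (codeFP_eval e₂))).congr fun _ => rfl
  | .mul e₁ e₂ => (natMul.comp ((codeFP_eval e₁).pair (codeFP_eval e₂))).congr fun _ => rfl
  | .div e₁ e₂ => (natDiv.comp ((codeFP_eval e₁).pair (codeFP_eval e₂))).congr fun _ => rfl
  | .emod e₁ e₂ => (natMod.comp ((codeFP_eval e₁).pair (codeFP_eval e₂))).congr fun _ => rfl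
  | .lt e₁ e₂ => (ite (natLt.comp ((codeFP_eval e₁).pair (codeFP_eval e₂))) (const _ 1) (const _ 0)).congr fun E => by
      rw [AExp.eval_lt]; by_cases h : e₁.eval E < e₂.eval E <;> simp [h]
  | .beq e₁ e₂ => (ite (natEq.comp ((codeFP_eval e₁).pair (codeFP_eval e₂))) (const _ 1) (const _ 0)).congr fun E => by
      rw [AExp.eval_beq]; by_cases h : e₁.eval E = e₂.eval E <;> simp [h]
  | .cond c e₁ e₂ => (ite (natEq.comp ((codeFP_eval c).pair (const _ 0))) (codeFP_eval e₂) (codeFP_eval e₁)).congr fun E => by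
      rw [AExp.eval_cond]; by_cases h : c.eval E = 0 <;> simp [h]

/-- **A fixed list of expressions** is evaluated (to a raw list of binary numerals) in typed
polynomial time. [cite: AroraBarak2009, §1.3] -/
theorem codeFP_evalList : ∀ l : List AExp, CodeFP aenvE (rawE natE) (fun E => l.map (AExp.eval E))
  | [] => const _ []
  | e :: l => ((rawCons natE).comp ((codeFP_eval e).pair (codeFP_evalList l))).congr fun _ => rfl

/-- **A fixed flag** is computed in typed polynomial time. [cite: AroraBarak2009, §1.3] -/
theorem codeFP_flag (e : AExp) : CodeFP aenvE bitE (fun E => e.flag E) :=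
  (CodeFP.not (natEq.comp ((codeFP_eval e).pair (const _ 0)))).congr fun _ => rfl

/-- Evaluation in an environment computed from a parameter. [folklore] -/
theorem codeFP_eval' {β : Type} {eβ : β → List Bool} {env : β → AEnv} (henv : CodeFP eβ aenvE env) (e : AExp) :
    CodeFP eβ natE (fun b => e.eval (env b)) :=
  (codeFP_eval e).comp henv

/-- A list of evaluations in an environment computed from a parameter. [folklore] -/
theorem codeFP_evalList' {β : Type} {eβ : β → List Bool} {env : β → AEnv} (henv : CodeFP eβ aenvE env) (l : List AExp) :
    CodeFP eβ (rawE natE) (fun b => l.map (AExp.eval (env b))) :=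
  (codeFP_evalList l).comp henv

/-- A flag in an environment computed from a parameter. [folklore] -/
theorem codeFP_flag' {β : Type} {eβ : β → List Bool} {env : β → AEnv} (henv : CodeFP eβ aenvE env) (e : AExp) :
    CodeFP eβ bitE (fun b => e.flag (env b)) :=
  (codeFP_flag e).comp henv

/-- **Assembling an environment** from computed scalars and tables. [folklore] -/
theorem codeFP_mkEnv {β : Type} {eβ : β → List Bool} {sc : β → List ℕ} {tb : β → List (List ℕ)}
    (hsc : CodeFP eβ (rawE natE) sc) (htb : CodeFP eβ (rawE (rawE natE)) tb) :
    CodeFP eβ aenvE (fun b => (sc b, tb b)) :=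
  hsc.pair htb

/-- A list of scalars from finitely many computed numbers: cons. [folklore] -/
theorem codeFP_consNat {β : Type} {eβ : β → List Bool} {x : β → ℕ} {l : β → List ℕ}
    (hx : CodeFP eβ natE x) (hl : CodeFP eβ (rawE natE) l) : CodeFP eβ (rawE natE) (fun b => x b :: l b) :=
  (rawCons natE).comp (hx.pair hl)

/-- A list of tables from finitely many computed tables: cons. [folklore] -/
theorem codeFP_consTbl {β : Type} {eβ : β → List Bool} {x : β → List ℕ} {l : β → List (List ℕ)}
    (hx : CodeFP eβ (rawE natE) x) (hl : CodeFP eβ (rawE (rawE natE)) l) :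
    CodeFP eβ (rawE (rawE natE)) (fun b => x b :: l b) :=
  (rawCons (rawE natE)).comp (hx.pair hl)

end CodeFP

end Literature.Computability.Complexity
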